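import Summits.QuantumFields.BalabanUV.Beta.D1BFx.ColumnGaugeInvariance
import Summits.QuantumFields.BalabanUV.Beta.D1BFx.ChartDefectResolvent

/-!
# `BalabanUV.Beta.D1BFx.ColumnGaugeTwoPins` — road «BF-x», binder row D1, PART 24 HEAD (H3) (an2 R-D1-g44-2 (α′), R-D1-g45-3): **THE COLUMN-GAUGE
# INVARIANCE READ AT THE TWO PINS** — the road's word at `G₀^{bm}` (relative inverse of the STRAIGHT border `bhK`) and the literal's word at
# `GcombSh n 0 = Ψ̂∘G₀^{bm}∘Ψ̂ᵀ` (relative inverse of the LEGGED border `bhK + Dsh`, SAME slice projector), when the TABLES' slot letters have the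
# legged border as partner: §1 at the road's pin the cancellation is `hessKer_columnGauge_of_relInv` REGROUPED and leaves exactly the displayed words
# `G^{D} = [Λ, D]`, `W^{D} = −[Λ_{νy′}, [Λ_{μy}, D]]` (an2's `G^{Dsh}`, priced at the bm pin); §2 at the literal's pin it is the theorem verbatim (nothing left);
# §3 the two smooth words then differ by PROPAGATOR-INSERTION words (one `D`-insertion each, `K′ = K − K∘X∘K′`); §4 the three at the level-0 kernels of the tree.

WHY (OWNER design note N-g24-1).  The (α′) chart of record keeps the road at `G₀^{bm}` and cancels every pure-gauge vertex word EXACTLY by the instance of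
`ColumnGaugeInvariance.hessKer_columnGauge_of_relInv` (gen 23).  The transport identities of the (J1) programme (leaf-03 TT3b∕TT10∕TT12, leaf-01
`DressedVertexSplit` ∕ TT15, the OWNER's `ColumnGaugeMergedFirstOrder`) are OPERATOR identities `V^{full} = V^{straight} + [Λ, 𝕄_S]` whose partner `𝕄_S` is
the one the TABLES' letters carry — for the comb literal `(n⁴∕2)•bhKAt + (−n⁸∕2)•ΔmfNeg` (`ColumnGaugeCombLetter`, F-g23-3), a LEGGED border —, while the two
`RelInv` sockets of the tree are `ChartDefectResolvent.relInv_G0bm_ctr : RelInv G₀^{bm} bhK axEc` (road) and `relInv_GcombSh_zero : RelInv (GcombSh n 0) (bhK + 1•Dsh) axEc`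
(literal).  So the ONE theorem is called TWICE: at the literal's own propagator with partner `M + D` (§2: everything cancels), and at the road's propagator with
partner `M` (§1: the mismatch `D` survives as the displayed words).  The difference of the two remaining SMOOTH words is a sum of propagator-insertion words (§3) —
the «pure chart (kernel) effect» Engine C measured in D-g22-1 (lit words on `G₀bm` = S2hyb, hyb words on `GcombSh` = S2lit to 7e−7).  Pricing is NOT moved to the
comb pin (R-D1-g45-3 (2)(b)): §2 is used as an IDENTITY only.

HONEST DEPENDENCY (cell records, verbatim): «continuum YM on T⁴ ⇐ BetaPertH ∧ nine spine estimates (0/9 proved); BetaPertH ⇐ (D1) ∧ (D4) ∧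
CAP+tail; G-an2-4 gates asym, D1 and NE2/3/4.»  HONEST FRAMING (cell contract, verbatim): «discharging `BetaPertH` makes Bałaban's UV stability
UNCONDITIONAL — a real constructive-QFT result; it is NOT the continuum limit and NOT the Clay problem.»  THIS MODULE DISCHARGES NOTHING of the wall:
[folklore] tame-kernel algebra (`comp_add∕sub_left∕right_tame`, `comp_assoc_tame`, `tr_add∕sub_loc`) over ABSTRACT kernels; the letters' OUTPUT shapes, the
`RelInv` facts and `K′ = K − K∘X∘K′` are HYPOTHESES in §1–§3 (§4 discharges the last two at level 0 BY NAME from `ChartDefectResolvent`); whether the road's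
tables produce the letters (and with which scalar — Q-g24-1) is the instance's burden, not claimed.  No definition, no `def … : Prop`, nothing cited, 0 sorry.
0∕4 row-D1 binders; (K) NOT closed; (J1) ONE OPEN ROW (three displayed words); NOT D1, NEVER «G-an2-4 closed», NOT `BetaPertH`, NOT continuum, NOT Clay.

ABSOLUTE RULE (cell charter, verbatim): «No internally-minted statement may enter as a cited fact. Every hypothesis is either kernel-proved in this
package or a verbatim quotation of a PUBLISHED theorem with page reference. The manuscript(s) under audit are NOT citable for their own disputed
steps — they are the thing under adjudication; programme-internal (2001/route/tribunal) claims are never citable.»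

Unit `b2b-balaban-beta-d1-p2` (road owner, gen 24), 2026-08-23; over `ColumnGaugeInvariance` (gen 23) and `ChartDefectResolvent` (gen 22) BY NAME; no existing file touched.
-/

noncomputable section

namespace Summit.QuantumFields.BalabanUV.Beta.D1BFx.ColumnGaugeTwoPins

open Literature.MathematicalPhysics.QuantumFieldTheory.Balaban1983to89
open Literature.MathematicalPhysics.QuantumFieldTheory.Balaban1983to89.Beta
open ExpKernelCalculus (MKer comp tr tadpole bubble hessKer)
open OneStepResolventKernel (Fib)
open OneStepKernelFamily (KInvStep)
open AveragingContoursRooted (ctr)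
open Summit.QuantumFields.BalabanUV.Beta.TameKernelCalculus
open Summit.QuantumFields.BalabanUV.Beta.ChartConjugationRelative (RelInv spr_comp)
open Summit.QuantumFields.BalabanUV.Beta.RelInvNullShift (spr_add)
open Summit.QuantumFields.BalabanUV.Beta.AxialDressingRooted (coDressKBmAt axEc spr_axEc one_le_of_neZero)
open Summit.QuantumFields.BalabanUV.Beta.CombChartStepJets (GcombSh)
open Summit.QuantumFields.BalabanUV.Beta.DshAn1 (Dsh spr_Dsh)
open Summit.QuantumFields.BalabanUV.Beta.BorderedHessian (bhK spr_bhK)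
open Summit.QuantumFields.BalabanUV.Beta.D1BFx.ColumnGaugeInvariance (hessKer_columnGauge_of_relInv loc_comm_spr)
open Summit.QuantumFields.BalabanUV.Beta.D1BFx.ChartDefectResolvent (relInv_G0bm_ctr relInv_GcombSh_zero spr_G0bm_ctr spr_GcombSh_zero
  GcombSh_zero_eq_sub_defect)

variable {D : ℕ} {F : Type*} [Fintype F]

/-! ## §1 The road's pin: the invariance REGROUPED — the partner mismatch survives as the displayed words `G^{D}`, `W^{D}` -/

section Regroup

variable {K M E Dk : MKer D F} {V Λ : Fin D → (Fin D → ℤ) → MKer D F} {W Nr : Fin D → (Fin D → ℤ) → Fin D → (Fin D → ℤ) → MKer D F}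

/-- [folklore] **THE REGROUPING** (pure kernel algebra: `M`, `D` spread, `V`, `Λ` localised).  If the first-order family is `V + [Λ, M + D]` and the
second-order family is `W + (Wmix(Λ; V) + [Λ μy, [Λ νy′, M + D]]) + Nr` — the OUTPUT of the slot letters when the tables' partner is the LEGGED border `M + D`
(`Wmix` against the straight `V`, `Wgg` against `M + D`) —, then both families ARE the families of `ColumnGaugeInvariance.hessKer_columnGauge_of_relInv` for the
partner `M` and the DISPLACED smooth families `V + G^{D}`, `W + W^{D}` with **`G^{D} μ y := [Λ μ y, D]`**, **`W^{D} μ y ν y′ := −[Λ ν y′, [Λ μ y, D]]`**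
(`[Λμ,[Λν, M + D]] = [Λμ,[Λν,M]] + [Λμ,[Λν,D]]`, `Wmix(V + G^{D}) = Wmix(V) + [Λν,[Λμ,D]] + [Λμ,[Λν,D]]`; `[A, B] := A∘B − B∘A`). -/
theorem hessKer_columnGauge_regroup (hM : Spr M) (hD : Spr Dk) (hV : ∀ μ y, Loc (V μ y)) (hΛ : ∀ μ y, Loc (Λ μ y)) (μ ν : Fin D) (z : Fin D → ℤ) :
    hessKer K (fun μ' y => V μ' y + (comp (Λ μ' y) (M + Dk) - comp (M + Dk) (Λ μ' y)))
        (fun μ' y ν' y' => W μ' y ν' y'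
          + ((((comp (Λ ν' y') (V μ' y) - comp (V μ' y) (Λ ν' y')) + (comp (Λ μ' y) (V ν' y') - comp (V ν' y') (Λ μ' y)))
            + (comp (Λ μ' y) (comp (Λ ν' y') (M + Dk) - comp (M + Dk) (Λ ν' y'))
                - comp (comp (Λ ν' y') (M + Dk) - comp (M + Dk) (Λ ν' y')) (Λ μ' y))) + Nr μ' y ν' y')) μ ν z
      = hessKer K (fun μ' y => (V μ' y + (comp (Λ μ' y) Dk - comp Dk (Λ μ' y))) + (comp (Λ μ' y) M - comp M (Λ μ' y)))
        (fun μ' y ν' y' => (W μ' y ν' y'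
            - (comp (Λ ν' y') (comp (Λ μ' y) Dk - comp Dk (Λ μ' y)) - comp (comp (Λ μ' y) Dk - comp Dk (Λ μ' y)) (Λ ν' y')))
          + ((((comp (Λ ν' y') (V μ' y + (comp (Λ μ' y) Dk - comp Dk (Λ μ' y))) - comp (V μ' y + (comp (Λ μ' y) Dk - comp Dk (Λ μ' y))) (Λ ν' y'))
              + (comp (Λ μ' y) (V ν' y' + (comp (Λ ν' y') Dk - comp Dk (Λ ν' y'))) - comp (V ν' y' + (comp (Λ ν' y') Dk - comp Dk (Λ ν' y'))) (Λ μ' y)))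
            + (comp (Λ μ' y) (comp (Λ ν' y') M - comp M (Λ ν' y')) - comp (comp (Λ ν' y') M - comp M (Λ ν' y')) (Λ μ' y))) + Nr μ' y ν' y')) μ ν z := by
  have hGD : ∀ μ y, Loc (comp (Λ μ y) Dk - comp Dk (Λ μ y)) := fun μ y => loc_comm_spr hD (hΛ μ y)
  have hGM : ∀ μ y, Loc (comp (Λ μ y) M - comp M (Λ μ y)) := fun μ y => loc_comm_spr hM (hΛ μ y)
  -- the first-order families agree
  have eV : (fun μ' y => V μ' y + (comp (Λ μ' y) (M + Dk) - comp (M + Dk) (Λ μ' y)))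
      = fun μ' y => (V μ' y + (comp (Λ μ' y) Dk - comp Dk (Λ μ' y))) + (comp (Λ μ' y) M - comp M (Λ μ' y)) := by
    funext μ' y
    rw [comp_add_right_tame (hΛ μ' y).tame hM.tame hD.tame, comp_add_left_tame hM.tame hD.tame (hΛ μ' y).tame]
    abel
  -- the second-order families agree
  have eW : (fun μ' y ν' y' => W μ' y ν' y'
          + ((((comp (Λ ν' y') (V μ' y) - comp (V μ' y) (Λ ν' y')) + (comp (Λ μ' y) (V ν' y') - comp (V ν' y') (Λ μ' y)))
            + (comp (Λ μ' y) (comp (Λ ν' y') (M + Dk) - comp (M + Dk) (Λ ν' y'))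
                - comp (comp (Λ ν' y') (M + Dk) - comp (M + Dk) (Λ ν' y')) (Λ μ' y))) + Nr μ' y ν' y'))
      = fun μ' y ν' y' => (W μ' y ν' y'
            - (comp (Λ ν' y') (comp (Λ μ' y) Dk - comp Dk (Λ μ' y)) - comp (comp (Λ μ' y) Dk - comp Dk (Λ μ' y)) (Λ ν' y')))
          + ((((comp (Λ ν' y') (V μ' y + (comp (Λ μ' y) Dk - comp Dk (Λ μ' y))) - comp (V μ' y + (comp (Λ μ' y) Dk - comp Dk (Λ μ' y))) (Λ ν' y'))
              + (comp (Λ μ' y) (V ν' y' + (comp (Λ ν' y') Dk - comp Dk (Λ ν' y'))) - comp (V ν' y' + (comp (Λ ν' y') Dk - comp Dk (Λ ν' y'))) (Λ μ' y)))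
            + (comp (Λ μ' y) (comp (Λ ν' y') M - comp M (Λ ν' y')) - comp (comp (Λ ν' y') M - comp M (Λ ν' y')) (Λ μ' y))) + Nr μ' y ν' y') := by
    funext μ' y ν' y'
    have ta := (hΛ μ' y).tame
    have tb := (hΛ ν' y').tame
    have tv := (hV μ' y).tame
    have tv' := (hV ν' y').tame
    have tgD := (hGD μ' y).tame
    have tgD' := (hGD ν' y').tame
    have tgM' := (hGM ν' y').tame
    -- the legged-border commutator splits
    have e0 : comp (Λ ν' y') (M + Dk) - comp (M + Dk) (Λ ν' y')
        = (comp (Λ ν' y') M - comp M (Λ ν' y')) + (comp (Λ ν' y') Dk - comp Dk (Λ ν' y')) := by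
      rw [comp_add_right_tame tb hM.tame hD.tame, comp_add_left_tame hM.tame hD.tame tb]
      abel
    rw [e0, comp_add_right_tame ta tgM' tgD', comp_add_left_tame tgM' tgD' ta, comp_add_right_tame tb tv tgD, comp_add_left_tame tv tgD tb,
      comp_add_right_tame ta tv' tgD', comp_add_left_tame tv' tgD' ta]
    abel
  rw [eV, eW]

/-- [folklore] **COLUMN-GAUGE INVARIANCE AT THE ROAD's PIN, REGROUPED AND CANCELLED.**  `RelInv K M E` (all spread), `D` spread, localised `V`, `W`,
`Nr` (tadpole-null at `K`), localised generators `Λ μ y` commuting with `E`: the letter output with partner `M + D` equals the functional of the DISPLACED smooth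
families ALONE, `hessKer K (V + G^{D}) (W + W^{D})` — the road's word at the bm pin = smooth words + the displayed `G^{Dsh}`∕`W^{Dsh}` words (R-D1-g45-3 (2)). -/
theorem hessKer_columnGauge_regroup_cancel (hK : Spr K) (hM : Spr M) (hE : Spr E) (hD : Spr Dk) (hR : RelInv K M E)
    (hV : ∀ μ y, Loc (V μ y)) (hΛ : ∀ μ y, Loc (Λ μ y)) (hΛE : ∀ μ y, comp (Λ μ y) E = comp E (Λ μ y))
    (hW : ∀ μ y ν y', Loc (W μ y ν y')) (hNr : ∀ μ y ν y', Loc (Nr μ y ν y')) (hN0 : ∀ μ y ν y', tadpole K (Nr μ y ν y') = 0)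
    (μ ν : Fin D) (z : Fin D → ℤ) :
    hessKer K (fun μ' y => V μ' y + (comp (Λ μ' y) (M + Dk) - comp (M + Dk) (Λ μ' y)))
        (fun μ' y ν' y' => W μ' y ν' y'
          + ((((comp (Λ ν' y') (V μ' y) - comp (V μ' y) (Λ ν' y')) + (comp (Λ μ' y) (V ν' y') - comp (V ν' y') (Λ μ' y)))
            + (comp (Λ μ' y) (comp (Λ ν' y') (M + Dk) - comp (M + Dk) (Λ ν' y'))
                - comp (comp (Λ ν' y') (M + Dk) - comp (M + Dk) (Λ ν' y')) (Λ μ' y))) + Nr μ' y ν' y')) μ ν z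
      = hessKer K (fun μ' y => V μ' y + (comp (Λ μ' y) Dk - comp Dk (Λ μ' y)))
        (fun μ' y ν' y' => W μ' y ν' y'
            - (comp (Λ ν' y') (comp (Λ μ' y) Dk - comp Dk (Λ μ' y)) - comp (comp (Λ μ' y) Dk - comp Dk (Λ μ' y)) (Λ ν' y'))) μ ν z := by
  have hGD : ∀ μ y, Loc (comp (Λ μ y) Dk - comp Dk (Λ μ y)) := fun μ y => loc_comm_spr hD (hΛ μ y)
  rw [hessKer_columnGauge_regroup hM hD hV hΛ μ ν z]
  exact hessKer_columnGauge_of_relInv hK hM hE hR (V := fun μ y => V μ y + (comp (Λ μ y) Dk - comp Dk (Λ μ y)))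
    (W := fun μ y ν y' => W μ y ν y' - (comp (Λ ν y') (comp (Λ μ y) Dk - comp Dk (Λ μ y)) - comp (comp (Λ μ y) Dk - comp Dk (Λ μ y)) (Λ ν y')))
    (fun μ y => (hV μ y).add (hGD μ y)) hΛ hΛE
    (fun μ y ν y' => (hW μ y ν y').sub (((hΛ ν y').comp (hGD μ y)).sub ((hGD μ y).comp (hΛ ν y')))) hNr hN0 μ ν z

end Regroup

/-! ## §2 The literal's pin: partner = the legged border itself — the theorem verbatim, nothing displayed -/

section LiteralPin

variable {K' M E Dk : MKer D F} {V Λ : Fin D → (Fin D → ℤ) → MKer D F} {W Nr' : Fin D → (Fin D → ℤ) → Fin D → (Fin D → ℤ) → MKer D F}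

/-- [folklore] **COLUMN-GAUGE INVARIANCE AT THE LITERAL's PIN**: if `K′` is the relative inverse of the LEGGED border `M + D` itself (the tree:
`ChartDefectResolvent.relInv_GcombSh_zero`), the SAME letter output cancels COMPLETELY — `hessKer K′ (V + [Λ, M + D]) (W + Wmix + Wgg(M + D) + Nr′) = hessKer K′ V W`
(`hessKer_columnGauge_of_relInv` at `(K′, M + D, E)`; `Nr′` tadpole-null at `K′`).  Used as an IDENTITY only (pricing stays at the bm pin). -/
theorem hessKer_columnGauge_literalPin (hK' : Spr K') (hM : Spr M) (hE : Spr E) (hD : Spr Dk) (hR' : RelInv K' (M + Dk) E)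
    (hV : ∀ μ y, Loc (V μ y)) (hΛ : ∀ μ y, Loc (Λ μ y)) (hΛE : ∀ μ y, comp (Λ μ y) E = comp E (Λ μ y))
    (hW : ∀ μ y ν y', Loc (W μ y ν y')) (hNr' : ∀ μ y ν y', Loc (Nr' μ y ν y')) (hN0' : ∀ μ y ν y', tadpole K' (Nr' μ y ν y') = 0)
    (μ ν : Fin D) (z : Fin D → ℤ) :
    hessKer K' (fun μ' y => V μ' y + (comp (Λ μ' y) (M + Dk) - comp (M + Dk) (Λ μ' y)))
        (fun μ' y ν' y' => W μ' y ν' y'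
          + ((((comp (Λ ν' y') (V μ' y) - comp (V μ' y) (Λ ν' y')) + (comp (Λ μ' y) (V ν' y') - comp (V ν' y') (Λ μ' y)))
            + (comp (Λ μ' y) (comp (Λ ν' y') (M + Dk) - comp (M + Dk) (Λ ν' y'))
                - comp (comp (Λ ν' y') (M + Dk) - comp (M + Dk) (Λ ν' y')) (Λ μ' y))) + Nr' μ' y ν' y')) μ ν z
      = hessKer K' V W μ ν z :=
  hessKer_columnGauge_of_relInv hK' (spr_add hM hD) hE hR' hV hΛ hΛE hW hNr' hN0' μ ν z

end LiteralPin

/-! ## §3 The two smooth words differ by PROPAGATOR-INSERTION words -/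

section Insertion

variable {K K' X : MKer D F}

/-- [folklore] **ONE-INSERTION TADPOLE**: `K′ = K − K∘X∘K′` (both spread), `W` localised ⟹ `tadpole K′ W − tadpole K W = −tr (K∘X∘K′∘W)`. -/
theorem tadpole_sub_tadpole_of_insertion (hK : Spr K) (hK' : Spr K') (hins : K' = K - comp (comp K X) K') {W : MKer D F} (hW : Loc W) :
    tadpole K' W - tadpole K W = -tr (comp (comp (comp K X) K') W) := by
  have e : K - K' = comp (comp K X) K' :=
    calc K - K' = K - (K - comp (comp K X) K') := by rw [← hins]
      _ = comp (comp K X) K' := sub_sub_cancel _ _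
  unfold ExpKernelCalculus.tadpole
  rw [← neg_sub, ← tr_sub_loc (hK.comp_loc hW) (hK'.comp_loc hW), ← comp_sub_left_tame hK.tame hK'.tame hW.tame, e]

/-- [folklore] **ONE-INSERTION BUBBLE**: `bubble K′ V V′ − bubble K V V′ = −(tr (K∘X∘K′∘V∘K′∘V′) + tr (K∘V∘K∘X∘K′∘V′))`
(`(K∘X∘K′)∘V∘K′∘V′ + K∘V∘(K∘X∘K′)∘V′ = K∘V∘K∘V′ − K′∘V∘K′∘V′` with `K∘X∘K′ = K − K′`). -/
theorem bubble_sub_bubble_of_insertion (hK : Spr K) (hK' : Spr K') (hins : K' = K - comp (comp K X) K') {V V' : MKer D F} (hV : Loc V) (hV' : Loc V') :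
    bubble K' V V' - bubble K V V'
      = -(tr (comp (comp (comp (comp K X) K') V) (comp K' V')) + tr (comp (comp K V) (comp (comp (comp K X) K') V'))) := by
  have e : comp (comp K X) K' = K - K' :=
    (calc K - K' = K - (K - comp (comp K X) K') := by rw [← hins]
      _ = comp (comp K X) K' := sub_sub_cancel _ _).symm
  have hKV : Loc (comp K V) := hK.comp_loc hV
  have hK'V : Loc (comp K' V) := hK'.comp_loc hV
  have hKV' : Loc (comp K V') := hK.comp_loc hV'
  have hK'V' : Loc (comp K' V') := hK'.comp_loc hV'
  unfold ExpKernelCalculus.bubble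
  rw [e, comp_sub_left_tame hK.tame hK'.tame hV.tame, comp_sub_left_tame hK.tame hK'.tame hV'.tame,
    comp_sub_left_tame hKV.tame hK'V.tame hK'V'.tame, comp_sub_right_tame hKV.tame hKV'.tame hK'V'.tame,
    tr_sub_loc (hKV.comp hK'V') (hK'V.comp hK'V'), tr_sub_loc (hKV.comp hKV') (hKV.comp hK'V')]
  ring

/-- [folklore] **THE ONE-LOOP FUNCTIONAL AT `K′` MINUS AT `K` = INSERTION WORDS**: for localised families `V`, `W` and `K′ = K − K∘X∘K′`,
`hessKer K′ V W μ ν z − hessKer K V W μ ν z = −½·tr (K∘X∘K′∘W μ0νz) + ½·(tr (K∘X∘K′∘V μ0∘K′∘V νz) + tr (K∘V μ0∘K∘X∘K′∘V νz))` — every word carries ONE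
insertion of `X` (at the road: `X = Dsh`, `K = G₀^{bm}`, `K′ = GcombSh n 0`; the «pure chart effect» of Engine C's D-g22-1). -/
theorem hessKer_sub_hessKer_of_insertion (hK : Spr K) (hK' : Spr K') (hins : K' = K - comp (comp K X) K')
    {V : Fin D → (Fin D → ℤ) → MKer D F} {W : Fin D → (Fin D → ℤ) → Fin D → (Fin D → ℤ) → MKer D F}
    (hV : ∀ μ y, Loc (V μ y)) (hW : ∀ μ y ν y', Loc (W μ y ν y')) (μ ν : Fin D) (z : Fin D → ℤ) :
    hessKer K' V W μ ν z - hessKer K V W μ ν z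
      = -((1 / 2) * tr (comp (comp (comp K X) K') (W μ 0 ν z)))
        + (1 / 2) * (tr (comp (comp (comp (comp K X) K') (V μ 0)) (comp K' (V ν z))) + tr (comp (comp K (V μ 0)) (comp (comp (comp K X) K') (V ν z)))) := by
  have ht := tadpole_sub_tadpole_of_insertion hK hK' hins (hW μ 0 ν z)
  have hb := bubble_sub_bubble_of_insertion hK hK' hins (hV μ 0) (hV ν z)
  unfold ExpKernelCalculus.hessKer
  linear_combination (1 / 2 : ℝ) * ht - (1 / 2 : ℝ) * hb

end Insertion

/-! ## §4 The level-0 kernels of the tree: road `G₀^{bm}(ρ_c)`, literal `GcombSh Lc 0`, straight border `bhK`, legged border `bhK + Dsh`, slice `axEc ρ_c` -/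

section LevelZero

variable {d : ℕ} {Lc : ℕ} [NeZero Lc]
  {V Λ : Fin (d + 1) → (Fin (d + 1) → ℤ) → MKer (d + 1) (Fib d)} {W Nr Nr' : Fin (d + 1) → (Fin (d + 1) → ℤ) → Fin (d + 1) → (Fin (d + 1) → ℤ) → MKer (d + 1) (Fib d)}
  (hV : ∀ μ y, Loc (V μ y)) (hΛ : ∀ μ y, Loc (Λ μ y)) (hΛE : ∀ μ y, comp (Λ μ y) (axEc (ctr (d + 1) Lc) Lc) = comp (axEc (ctr (d + 1) Lc) Lc) (Λ μ y))
  (hW : ∀ μ y ν y', Loc (W μ y ν y'))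
include hV hΛ hΛE hW

/-- [folklore] **ROAD SIDE AT LEVEL 0**: at `K := G₀^{bm}(ρ_c) = coDressKBmAt (ctr (d+1) Lc) Lc (KInvStep Lc 0)` (`RelInv … (bhK Lc) (axEc ρ_c Lc)`,
`ChartDefectResolvent.relInv_G0bm_ctr`), for ANY localised `V`, `W`, tadpole-null `Nr` and localised generators commuting with `axEc ρ_c Lc`, the letter output with
partner `bhK Lc + Dsh Lc` reduces to the displaced smooth words with `G^{Dsh} = [Λ, Dsh Lc]`, `W^{Dsh} = −[Λν′, [Λμ, Dsh Lc]]`. -/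
theorem hessKer_G0bm_regroup_cancel (hNr : ∀ μ y ν y', Loc (Nr μ y ν y'))
    (hN0 : ∀ μ y ν y', tadpole (coDressKBmAt (ctr (d + 1) Lc) Lc (KInvStep (d := d) Lc 0)) (Nr μ y ν y') = 0) (μ ν : Fin (d + 1)) (z : Fin (d + 1) → ℤ) :
    hessKer (coDressKBmAt (ctr (d + 1) Lc) Lc (KInvStep (d := d) Lc 0))
        (fun μ' y => V μ' y + (comp (Λ μ' y) (bhK Lc + Dsh Lc) - comp (bhK Lc + Dsh Lc) (Λ μ' y)))
        (fun μ' y ν' y' => W μ' y ν' y'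
          + ((((comp (Λ ν' y') (V μ' y) - comp (V μ' y) (Λ ν' y')) + (comp (Λ μ' y) (V ν' y') - comp (V ν' y') (Λ μ' y)))
            + (comp (Λ μ' y) (comp (Λ ν' y') (bhK Lc + Dsh Lc) - comp (bhK Lc + Dsh Lc) (Λ ν' y'))
                - comp (comp (Λ ν' y') (bhK Lc + Dsh Lc) - comp (bhK Lc + Dsh Lc) (Λ ν' y')) (Λ μ' y))) + Nr μ' y ν' y')) μ ν z
      = hessKer (coDressKBmAt (ctr (d + 1) Lc) Lc (KInvStep (d := d) Lc 0))
        (fun μ' y => V μ' y + (comp (Λ μ' y) (Dsh Lc) - comp (Dsh Lc) (Λ μ' y)))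
        (fun μ' y ν' y' => W μ' y ν' y'
            - (comp (Λ ν' y') (comp (Λ μ' y) (Dsh Lc) - comp (Dsh Lc) (Λ μ' y)) - comp (comp (Λ μ' y) (Dsh Lc) - comp (Dsh Lc) (Λ μ' y)) (Λ ν' y'))) μ ν z :=
  have hL : 1 ≤ Lc := one_le_of_neZero Lc
  hessKer_columnGauge_regroup_cancel spr_G0bm_ctr (spr_bhK hL) (spr_axEc _ _) (spr_Dsh hL) relInv_G0bm_ctr hV hΛ hΛE hW hNr hN0 μ ν z

/-- [folklore] **LITERAL SIDE AT LEVEL 0**: at `K′ := GcombSh Lc 0` (`RelInv … (bhK Lc + 1•Dsh Lc) (axEc ρ_c Lc)`, `ChartDefectResolvent.relInv_GcombSh_zero`) the same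
letter output cancels completely (`Nr′` tadpole-null at `GcombSh Lc 0`). -/
theorem hessKer_GcombSh_cancel (hNr' : ∀ μ y ν y', Loc (Nr' μ y ν y')) (hN0' : ∀ μ y ν y', tadpole (GcombSh (d := d) Lc 0) (Nr' μ y ν y') = 0)
    (μ ν : Fin (d + 1)) (z : Fin (d + 1) → ℤ) :
    hessKer (GcombSh (d := d) Lc 0)
        (fun μ' y => V μ' y + (comp (Λ μ' y) (bhK Lc + Dsh Lc) - comp (bhK Lc + Dsh Lc) (Λ μ' y)))
        (fun μ' y ν' y' => W μ' y ν' y'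
          + ((((comp (Λ ν' y') (V μ' y) - comp (V μ' y) (Λ ν' y')) + (comp (Λ μ' y) (V ν' y') - comp (V ν' y') (Λ μ' y)))
            + (comp (Λ μ' y) (comp (Λ ν' y') (bhK Lc + Dsh Lc) - comp (bhK Lc + Dsh Lc) (Λ ν' y'))
                - comp (comp (Λ ν' y') (bhK Lc + Dsh Lc) - comp (bhK Lc + Dsh Lc) (Λ ν' y')) (Λ μ' y))) + Nr' μ' y ν' y')) μ ν z
      = hessKer (GcombSh (d := d) Lc 0) V W μ ν z := by
  have hL : 1 ≤ Lc := one_le_of_neZero Lc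
  have hR' : RelInv (GcombSh (d := d) Lc 0) (bhK Lc + Dsh Lc) (axEc (ctr (d + 1) Lc) Lc) := by
    have h := relInv_GcombSh_zero (d := d) (Lc := Lc)
    rwa [one_smul] at h
  exact hessKer_columnGauge_literalPin spr_GcombSh_zero (spr_bhK hL) (spr_axEc _ _) (spr_Dsh hL) hR' hV hΛ hΛE hW hNr' hN0' μ ν z

omit hΛ hΛE in
/-- [folklore] **THE TWO SMOOTH WORDS AT LEVEL 0 DIFFER BY `Dsh`-INSERTION WORDS** (`ChartDefectResolvent.GcombSh_zero_eq_sub_defect`: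
`GcombSh Lc 0 = G₀^{bm} − G₀^{bm}∘Dsh∘GcombSh Lc 0`). -/
theorem hessKer_GcombSh_sub_hessKer_G0bm (μ ν : Fin (d + 1)) (z : Fin (d + 1) → ℤ) :
    hessKer (GcombSh (d := d) Lc 0) V W μ ν z - hessKer (coDressKBmAt (ctr (d + 1) Lc) Lc (KInvStep (d := d) Lc 0)) V W μ ν z
      = -((1 / 2) * tr (comp (comp (comp (coDressKBmAt (ctr (d + 1) Lc) Lc (KInvStep (d := d) Lc 0)) (Dsh Lc)) (GcombSh (d := d) Lc 0)) (W μ 0 ν z)))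
        + (1 / 2) * (tr (comp (comp (comp (comp (coDressKBmAt (ctr (d + 1) Lc) Lc (KInvStep (d := d) Lc 0)) (Dsh Lc)) (GcombSh (d := d) Lc 0)) (V μ 0))
              (comp (GcombSh (d := d) Lc 0) (V ν z)))
          + tr (comp (comp (coDressKBmAt (ctr (d + 1) Lc) Lc (KInvStep (d := d) Lc 0)) (V μ 0))
              (comp (comp (comp (coDressKBmAt (ctr (d + 1) Lc) Lc (KInvStep (d := d) Lc 0)) (Dsh Lc)) (GcombSh (d := d) Lc 0)) (V ν z)))) :=
  hessKer_sub_hessKer_of_insertion spr_G0bm_ctr spr_GcombSh_zero GcombSh_zero_eq_sub_defect hV hW μ ν z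

end LevelZero

end Summit.QuantumFields.BalabanUV.Beta.D1BFx.ColumnGaugeTwoPins

end
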